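import Literature.Topology.FourManifolds.LatticeFormsOrthoSumSignature
import HarnessLib

/-!
# Additivity of the signature along two isometric embeddings detected by two restrictions

J.-P. Serre, *A Course in Arithmetic* (1973), Ch. V §1.3.7 (the index is additive over orthogonal
sums) in the form produced by the cohomology of a boundary connected sum (M. Kervaire,
J. Milnor, *Groups of homotopy spheres I* (1963), §2 p. 508, "clearly has signature
`σ(M) = σ(M₁) + σ(M₂)`"): a form `Q` on `W` receives two forms `B₁` on `V`, `B₂` on `V'` through
linear maps `ι₁ : V → W`, `ι₂ : V' → W` which are isometric, mutually orthogonal, and whose sum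
`V ⊕ V' → W` is shown to be bijective by two "restriction" maps `ρ₁ : W → X₁`, `ρ₂ : W → X₂`
(jointly injective, killing the opposite summand, bijective on the matching one — as the
restrictions to the two halves of an open cover do for the collapse maps). Then
`τ(Q) = τ(B₁) + τ(B₂)`.

* `LinearMap.BilinForm.bijective_coprod_of_restrictions` — the linear-algebra lemma;
* `LinearMap.BilinForm.signature_eq_add_of_embeddings` — the additivity.

Everything is proved; no named facts.

## References

* J.-P. Serre, *A Course in Arithmetic*, GTM 7, Springer 1973, Ch. V §1.3.7. [Serre1973]
* M. A. Kervaire, J. W. Milnor, *Groups of homotopy spheres: I*, Ann. of Math. 77 (1963),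
  §2 p. 508. [KervaireMilnorAnnals1963]
-/

noncomputable section

open Module Function

namespace LinearMap.BilinForm

variable {W V V' X₁ X₂ : Type*} [AddCommGroup W] [AddCommGroup V] [AddCommGroup V']
  [AddCommGroup X₁] [AddCommGroup X₂] [Module ℤ W] [Module ℤ V] [Module ℤ V'] [Module ℤ X₁]
  [Module ℤ X₂]

/-- **Two maps into `W` whose sum is bijective, detected by two restrictions**: if
`ρ₁ ∘ ι₁`, `ρ₂ ∘ ι₂` are bijective, `ρ₁ ∘ ι₂ = 0`, `ρ₂ ∘ ι₁ = 0` and `(ρ₁, ρ₂)` is jointly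
injective, then `(a, b) ↦ ι₁ a + ι₂ b` is bijective. [folklore] -/
theorem bijective_coprod_of_restrictions (ι₁ : V →ₗ[ℤ] W) (ι₂ : V' →ₗ[ℤ] W) (ρ₁ : W →ₗ[ℤ] X₁)
    (ρ₂ : W →ₗ[ℤ] X₂) (hinj : ∀ w, ρ₁ w = 0 → ρ₂ w = 0 → w = 0)
    (h₁₁ : Bijective (ρ₁ ∘ₗ ι₁)) (h₂₂ : Bijective (ρ₂ ∘ₗ ι₂)) (h₁₂ : ρ₁ ∘ₗ ι₂ = 0)
    (h₂₁ : ρ₂ ∘ₗ ι₁ = 0) : Bijective (ι₁.coprod ι₂) := by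
  have e₁₂ : ∀ b, ρ₁ (ι₂ b) = 0 := fun b => LinearMap.congr_fun h₁₂ b
  have e₂₁ : ∀ a, ρ₂ (ι₁ a) = 0 := fun a => LinearMap.congr_fun h₂₁ a
  constructor
  · rw [injective_iff_map_eq_zero]
    rintro ⟨a, b⟩ hab
    rw [LinearMap.coprod_apply] at hab
    have ha : (ρ₁ ∘ₗ ι₁) a = 0 := by
      have := congrArg ρ₁ hab
      rwa [map_add, e₁₂, add_zero, map_zero] at this
    have hb : (ρ₂ ∘ₗ ι₂) b = 0 := by
      have := congrArg ρ₂ hab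
      rwa [map_add, e₂₁, zero_add, map_zero] at this
    have ha0 : a = 0 := h₁₁.1 (by rw [ha, map_zero])
    have hb0 : b = 0 := h₂₂.1 (by rw [hb, map_zero])
    rw [ha0, hb0, Prod.mk_zero_zero]
  · intro w
    obtain ⟨a, ha⟩ := h₁₁.2 (ρ₁ w)
    obtain ⟨b, hb⟩ := h₂₂.2 (ρ₂ w)
    refine ⟨(a, b), ?_⟩
    have h0 : w - (ι₁ a + ι₂ b) = 0 := by
      apply hinj
      · rw [map_sub, map_add, e₁₂, add_zero, sub_eq_zero]
        exact ha.symm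
      · rw [map_sub, map_add, e₂₁, zero_add, sub_eq_zero]
        exact hb.symm
    rw [LinearMap.coprod_apply]
    exact (sub_eq_zero.1 h0).symm

/-- **Additivity of the index along two orthogonal isometric embeddings whose sum is bijective**
(Serre 1973, Ch. V §1.3.7; the shape of Kervaire–Milnor 1963, §2 p. 508,
`σ(W₁ ♮ W₂) = σ(W₁) + σ(W₂)`): with `ι₁`, `ι₂`, `ρ₁`, `ρ₂` as in
`bijective_coprod_of_restrictions`, `Q (ι₁ a) (ι₁ a') = B₁ a a'`, `Q (ι₂ b) (ι₂ b') = B₂ b b'`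
and vanishing cross terms, `τ(Q) = τ(B₁) + τ(B₂)` (`B₁`, `B₂` symmetric, all modules finitely
generated). [cite: Serre1973, Ch. V §1.3.7] -/
theorem signature_eq_add_of_embeddings [Module.Finite ℤ W] [Module.Finite ℤ V] [Module.Finite ℤ V']
    (Q : LinearMap.BilinForm ℤ W) (B₁ : LinearMap.BilinForm ℤ V) (B₂ : LinearMap.BilinForm ℤ V')
    (h₁ : B₁.IsSymm) (h₂ : B₂.IsSymm) (ι₁ : V →ₗ[ℤ] W) (ι₂ : V' →ₗ[ℤ] W) (ρ₁ : W →ₗ[ℤ] X₁)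
    (ρ₂ : W →ₗ[ℤ] X₂) (hinj : ∀ w, ρ₁ w = 0 → ρ₂ w = 0 → w = 0)
    (h₁₁ : Bijective (ρ₁ ∘ₗ ι₁)) (h₂₂ : Bijective (ρ₂ ∘ₗ ι₂)) (h₁₂ : ρ₁ ∘ₗ ι₂ = 0)
    (h₂₁ : ρ₂ ∘ₗ ι₁ = 0) (hQ₁₁ : ∀ a a', Q (ι₁ a) (ι₁ a') = B₁ a a')
    (hQ₂₂ : ∀ b b', Q (ι₂ b) (ι₂ b') = B₂ b b') (hQ₁₂ : ∀ a b, Q (ι₁ a) (ι₂ b) = 0)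
    (hQ₂₁ : ∀ b a, Q (ι₂ b) (ι₁ a) = 0) :
    Q.signature = B₁.signature + B₂.signature := by
  have e₁₂ : ∀ b, ρ₁ (ι₂ b) = 0 := fun b => LinearMap.congr_fun h₁₂ b
  have e₂₁ : ∀ a, ρ₂ (ι₁ a) = 0 := fun a => LinearMap.congr_fun h₂₁ a
  -- the projections `πᵢ = (ρᵢ ∘ ιᵢ)⁻¹ ∘ ρᵢ` (no product module is named)
  set f₁ := LinearEquiv.ofBijective (ρ₁ ∘ₗ ι₁) h₁₁ with hf₁
  set f₂ := LinearEquiv.ofBijective (ρ₂ ∘ₗ ι₂) h₂₂ with hf₂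
  let π₁ : W →ₗ[ℤ] V := f₁.symm.toLinearMap ∘ₗ ρ₁
  let π₂ : W →ₗ[ℤ] V' := f₂.symm.toLinearMap ∘ₗ ρ₂
  have hπ₁ : ∀ w, π₁ w = f₁.symm (ρ₁ w) := fun w => rfl
  have hπ₂ : ∀ w, π₂ w = f₂.symm (ρ₂ w) := fun w => rfl
  have hf₁a : ∀ a, f₁ a = ρ₁ (ι₁ a) := fun a => rfl
  have hf₂b : ∀ b, f₂ b = ρ₂ (ι₂ b) := fun b => rfl
  have hπ₁ι : ∀ a b, π₁ (ι₁ a + ι₂ b) = a := fun a b => by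
    rw [hπ₁, map_add, e₁₂, add_zero, ← hf₁a, LinearEquiv.symm_apply_apply]
  have hπ₂ι : ∀ a b, π₂ (ι₁ a + ι₂ b) = b := fun a b => by
    rw [hπ₂, map_add, e₂₁, zero_add, ← hf₂b, LinearEquiv.symm_apply_apply]
  have hdec : ∀ w, w = ι₁ (π₁ w) + ι₂ (π₂ w) := fun w => by
    have h0 : w - (ι₁ (π₁ w) + ι₂ (π₂ w)) = 0 := by
      apply hinj
      · rw [map_sub, map_add, e₁₂, add_zero, sub_eq_zero, hπ₁, ← hf₁a, LinearEquiv.apply_symm_apply]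
      · rw [map_sub, map_add, e₂₁, zero_add, sub_eq_zero, hπ₂, ← hf₂b, LinearEquiv.apply_symm_apply]
    exact (sub_eq_zero.1 h0)
  refine signature_eq_add_of_maps Q B₁ B₂ h₁ h₂ π₁ π₂ (fun w hw₁ hw₂ => ?_) (fun v v' => ?_)
    (fun x y => ?_)
  · rw [hdec w, hw₁, hw₂, map_zero, map_zero, add_zero]
  · exact ⟨ι₁ v + ι₂ v', hπ₁ι v v', hπ₂ι v v'⟩
  · conv_lhs => rw [hdec x, hdec y]
    simp only [map_add, LinearMap.add_apply, hQ₁₁, hQ₁₂, hQ₂₁, hQ₂₂]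
    abel

end LinearMap.BilinForm
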